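import Summits.BirchSwinnertonDyer.BirchSwinnertonDyer.Theses.DefiniteTheta
import Summits.BirchSwinnertonDyer.BirchSwinnertonDyer.Theorems.TamePinch.Negative.CMQuarticImage
import Literature.NumberTheory.EllipticCurves.MultiplicativeComponentGroupOrder
import Literature.NumberTheory.EllipticCurves.RootNumberProofs
import Literature.NumberTheory.EllipticCurves.PAdicHeightsProofs

/-!
# `DefiniteTheta.DefiniteExactOrder` (stmt-BirchSwinnertonDyer-18437), negative-side support:
# the multiplicative-sector hypothesis is load-bearing (this file does NOT refute the crux)

Kernel-checked by-products of the birth vetting of the crux `DefiniteExactOrder` (route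
`DefiniteTheta`), exported for the planner and the prover:

* `exists_hasMultiplicativeReductionAtPrime_of_definiteDatum` — **the sharp definite datum forces
  the multiplicative sector.** If `N_E = N⁺ · N⁻` with `gcd(N⁺, N⁻) = 1`, `N⁻` squarefree (a field of
  `Brandt.XiSetup N⁺ N⁻`) and `ω(N⁻)` odd (the definite sign condition), then `N⁻ > 1` has a prime
  factor `q ∥ N_E`, so `f_q(E) = 1` (`N_E = ∏ p ^ f_p`, tree `factorization_conductorNorm_holds`),
  i.e. `E` has multiplicative reduction at `q` (Silverman ATAEC IV.10.2(b), tree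
  `conductorExponent_eq_one_iff_holds`, and the prime-indexed comparison
  `hasMultiplicativeReductionAtPrime_iff_hasMultiplicativeReductionAt_holds`). Hence the hypothesis
  `∃ q, multiplicative at q` of the crux is not only sufficient for the datum to make sense but
  NECESSARY for its conclusion: the crux cannot be extended beyond the multiplicative sector in this
  shape (for the remaining curves the route's thesis points to split `M₂(ℚ)` / Heegner data instead).
* `not_hasMultiplicativeReductionAtPrime_of_j_eq_intCast` — a curve with integral `j`-invariant
  has no prime of multiplicative reduction (`‖j‖_q > 1` at a multiplicative `q`, AEC VII.5.1(b), tree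
  `one_lt_norm_j_of_hasMultiplicativeReductionAtPrime`).
* `definiteExactOrder_false_without_multiplicative` — **dropping the hypothesis
  `∃ q, V.HasMultiplicativeReductionAtPrime q` makes `DefiniteExactOrder` false**: the witness is
  `32a2 : y² = x³ − x` (`[0,0,0,−1,0]`, global minimal model, `j = 1728 ∈ ℤ`), for which no datum
  exists by the two lemmas above. Any proof of the crux must therefore use the hypothesis; and the
  statement as filed is correctly restricted.

Refuter seat refuter-rattack-stmt-BirchSwinnertonDyer-18437-0 (crux-attack at birth), 2026-08-17.
No new definitions; no statement of the route is asserted positively.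
-/

noncomputable section

-- D-0017: single-problem summit, so `Summit.BirchSwinnertonDyer.BirchSwinnertonDyer.…` repeats a
-- namespace BY DESIGN.
set_option linter.dupNamespace false

namespace Summit.BirchSwinnertonDyer.BirchSwinnertonDyer.Theorems.DefiniteExactOrder.Negative

open IsDedekindDomain WeierstrassCurve Literature.NumberTheory.EllipticCurves
  Literature.NumberTheory.Automorphic

/-- **The definite datum forces a multiplicative prime.** For an elliptic `V/ℚ`: if
`N_V = N⁺ N⁻`, `gcd(N⁺, N⁻) = 1`, `ω(N⁻)` odd and `N⁻` squarefree, then `V` has multiplicative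
reduction at some prime (namely at every `q ∣ N⁻`, since `q ∥ N_V` gives `f_q = 1`).
Silverman ATAEC IV.10.2(b) with the definition `N_E = ∏ p^{f_p}` (AEC C.16). [folklore] -/
theorem exists_hasMultiplicativeReductionAtPrime_of_definiteDatum (V : WeierstrassCurve ℚ)
    [V.IsElliptic] {Nplus Nminus : ℕ} (hN : V.conductorNorm ℤ = Nplus * Nminus)
    (hcop : Nat.Coprime Nplus Nminus) (hodd : Odd Nminus.primeFactors.card)
    (hsq : Squarefree Nminus) :
    ∃ (q : ℕ) (_ : Fact q.Prime), V.HasMultiplicativeReductionAtPrime q := by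
  -- a prime factor `q` of `N⁻` (there is one: `ω(N⁻)` is odd)
  have hne : Nminus.primeFactors.Nonempty := by
    rw [Finset.nonempty_iff_ne_empty]
    intro h
    rw [h, Finset.card_empty] at hodd
    exact Nat.not_odd_zero hodd
  obtain ⟨q, hq⟩ := hne
  have hqp : q.Prime := Nat.prime_of_mem_primeFactors hq
  have hqdvd : q ∣ Nminus := Nat.dvd_of_mem_primeFactors hq
  haveI hqfact : Fact q.Prime := ⟨hqp⟩
  refine ⟨q, hqfact, ?_⟩
  have hNminus0 : Nminus ≠ 0 := hsq.ne_zero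
  have hqNplus : ¬ q ∣ Nplus := fun h ↦
    hqp.one_lt.ne' (Nat.Coprime.eq_one_of_dvd (Nat.Coprime.coprime_dvd_left h hcop) hqdvd)
  have hNplus0 : Nplus ≠ 0 := by
    rintro rfl
    exact hqNplus (dvd_zero q)
  -- `q ∥ N_V`
  have hfac : (V.conductorNorm ℤ).factorization q = 1 := by
    rw [hN, Nat.factorization_mul hNplus0 hNminus0, Finsupp.add_apply,
      Nat.factorization_eq_zero_of_not_dvd hqNplus, zero_add]
    have hle := hsq.natFactorization_le_one q
    have hpos := hqp.factorization_pos_of_dvd hNminus0 hqdvd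
    omega
  -- hence `f_v = 1` at the place `v` of `ℤ` above `q`, i.e. multiplicative reduction at `v`
  set v : HeightOneSpectrum ℤ := (Rat.HeightOneSpectrum.primesEquiv (R := ℤ)).symm ⟨q, hqp⟩
    with hv
  have hgen : Rat.HeightOneSpectrum.natGenerator v = q := natGenerator_primesEquiv_symm hqp
  have hf : V.conductorExponent v = 1 := by
    have h := V.factorization_conductorNorm_holds v
    rw [hgen] at h
    rw [← h, hfac]
  have hmult : V.HasMultiplicativeReductionAt v :=
    (WeierstrassCurve.conductorExponent_eq_one_iff_holds v V).mp hf
  exact (V.hasMultiplicativeReductionAtPrime_iff_hasMultiplicativeReductionAt_holds ⟨q, hqp⟩).mpr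
    hmult

/-- **Integral `j` ⇒ no multiplicative prime**: if `j(V) ∈ ℤ` then `V` has multiplicative
reduction at no prime, since multiplicative reduction at `q` forces `‖j(V)‖_q > 1`
(Silverman AEC VII.5.1(b); ATAEC V.5). [cite: SilvermanAEC2009, Prop. VII.5.1(b)] -/
theorem not_hasMultiplicativeReductionAtPrime_of_j_eq_intCast (V : WeierstrassCurve ℚ)
    [V.IsElliptic] {n : ℤ} (hj : V.j = n) (q : ℕ) [Fact q.Prime] :
    ¬ V.HasMultiplicativeReductionAtPrime q := by
  intro h
  have h1 := one_lt_norm_j_of_hasMultiplicativeReductionAtPrime h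
  rw [hj, Rat.cast_intCast] at h1
  have h2 : ‖(n : ℚ_[q])‖ ≤ 1 := Padic.norm_int_le_one n
  linarith

/-- `j(32a2) = 1728`: for `V = [0,0,0,−1,0]` (`y² = x³ − x`), `c₄ = 48`, `Δ = 64`,
`j = 48³ / 64 = 1728`. [folklore] -/
theorem j_thirtyTwoA2 (hE : (⟨0, 0, 0, -1, 0⟩ : WeierstrassCurve ℚ).IsElliptic) :
    @WeierstrassCurve.j _ _ (⟨0, 0, 0, -1, 0⟩ : WeierstrassCurve ℚ) hE = (1728 : ℤ) := by
  have h1 : @WeierstrassCurve.j _ _ (⟨0, 0, 0, -1, 0⟩ : WeierstrassCurve ℚ) hE =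
      (⟨0, 0, 0, -1, 0⟩ : WeierstrassCurve ℚ).c₄ ^ 3 / (⟨0, 0, 0, -1, 0⟩ : WeierstrassCurve ℚ).Δ := by
    rw [j, ← coe_Δ', Units.val_inv_eq_inv_val]; ring
  rw [h1]
  simp only [WeierstrassCurve.c₄, WeierstrassCurve.Δ, WeierstrassCurve.b₂, WeierstrassCurve.b₄,
    WeierstrassCurve.b₆, WeierstrassCurve.b₈]
  norm_num

/-- **`DefiniteExactOrder` is false without its multiplicative-sector hypothesis** (any proof must
use `∃ q, V.HasMultiplicativeReductionAtPrime q`). Witness `32a2 = [0,0,0,−1,0]`: elliptic, a global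
minimal model (`tamePinch_isGloballyMinimal_thirtyTwoA2`), `j = 1728 ∈ ℤ`, so it has no multiplicative
prime (`not_hasMultiplicativeReductionAtPrime_of_j_eq_intCast`), whereas any datum as in the conclusion
would produce one (`exists_hasMultiplicativeReductionAtPrime_of_definiteDatum`, using the field
`Brandt.XiSetup.squarefree`). The conclusion below is that of
`Summit.BirchSwinnertonDyer.BirchSwinnertonDyer.Theses.DefiniteTheta.DefiniteExactOrder`, verbatim.
[folklore] -/
theorem definiteExactOrder_false_without_multiplicative :
    ¬ ∀ (V : WeierstrassCurve ℚ) [V.IsElliptic] [V.IsGloballyMinimal],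
      ∃ (p : ℕ) (_ : Fact p.Prime) (Nplus Nminus : ℕ) (K : Type) (_ : Field K) (_ : NumberField K)
        (S : Literature.NumberTheory.Automorphic.Brandt.XiSetup Nplus Nminus)
        (_ : Fintype (Literature.NumberTheory.Automorphic.Brandt.ClassSet S.O))
        (T : Literature.NumberTheory.EllipticCurves.GrossPointTower K S p)
        (φ : Literature.NumberTheory.Automorphic.Brandt.ClassSet S.O → ℤ),
        ((7 ≤ p ∧ V.HasGoodReductionAtPrime p ∧ ¬ (p : ℤ) ∣ V.frobeniusTrace p ∧
            ¬ (p : ℤ) ∣ (V.frobeniusTrace p) ^ 2 - 1 ∧ V.HasSurjectiveModNGaloisRep p ∧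
            (∀ q : ℕ, q.Prime → q ∣ V.conductorNorm ℤ → ¬ (p : ℤ) ∣ (q : ℤ) ^ 2 - 1) ∧
            ¬ p ∣ NumberField.classNumber K) ∧
          (Module.finrank ℚ K = 2 ∧ NumberField.IsTotallyComplex K ∧ NumberField.discr K < -4 ∧
            Int.gcd (NumberField.discr K) (V.conductorNorm ℤ * p) = 1) ∧
          (V.conductorNorm ℤ = Nplus * Nminus ∧ Nat.Coprime Nplus Nminus ∧
            Odd Nminus.primeFactors.card ∧
            (∀ q : ℕ, q.Prime → q ∣ Nplus →
              ((Ideal.span {(q : ℤ)}).primesOver (NumberField.RingOfIntegers K)).ncard = 2) ∧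
            (∀ q : ℕ, q.Prime → q ∣ Nminus →
              ((Ideal.span {(q : ℤ)}).primesOver (NumberField.RingOfIntegers K)).ncard = 1)) ∧
          (φ ≠ 0 ∧
            Literature.NumberTheory.Automorphic.Brandt.eigenLattice (Nplus * Nminus)
              (Literature.NumberTheory.Automorphic.Brandt.matrix S.O) (fun n => V.LFunction n) =
              Submodule.span ℤ {φ})) ∧
        T.acOrderOfVanishing p φ
            (Literature.NumberTheory.EllipticCurves.padicUnitRoot p (V.LFunction p)) ≤
          (V.analyticRank : ℕ∞) := by
  intro h
  haveI hE : (⟨0, 0, 0, -1, 0⟩ : WeierstrassCurve ℚ).IsElliptic := isElliptic_quartic (by norm_num)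
  haveI hM : (⟨0, 0, 0, -1, 0⟩ : WeierstrassCurve ℚ).IsGloballyMinimal :=
    tamePinch_isGloballyMinimal_thirtyTwoA2
  obtain ⟨p, _, Nplus, Nminus, K, _, _, S, _, T, φ, ⟨-, -, ⟨hN, hcop, hodd, -, -⟩, -⟩, -⟩ :=
    h ⟨0, 0, 0, -1, 0⟩
  obtain ⟨q, hq, hmult⟩ :=
    exists_hasMultiplicativeReductionAtPrime_of_definiteDatum _ hN hcop hodd S.squarefree
  exact not_hasMultiplicativeReductionAtPrime_of_j_eq_intCast _ (j_thirtyTwoA2 hE) q hmult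

end Summit.BirchSwinnertonDyer.BirchSwinnertonDyer.Theorems.DefiniteExactOrder.Negative

end
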